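import Mathlib
import HarnessLib
import Summits.Langlands.Langlands.Theses.SenNullAlignment

/-!
# Birth skeleton (BC3) for crux stmt-Langlands-16306
`Summit.Langlands.Langlands.Theses.SenNullAlignment.RegularServed` — line `birth`

Route `route-Langlands-SenNullAlignment` (rev 7; `closes (h1 : SingularProjectiveFinite)
(h2 : NonAlignedAtEll) (h3 : AlignedAtEll) (h4 : AwayFromEll) (hA : OddNonRegularAttached)
(hR : RegularServed) (hC : SectorComplement) : Langlands`; this crux is `hR`, rank 9 — it hands the
deciding theorem the reciprocity data `RD` for `K` and the whole odd REGULAR sector). THE CRUX: for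
every totally real `K` there are reciprocity data `RD : ReciprocityData K` serving the regular case —
every `L`-algebraic cuspidal `π` on `GL₂(𝔸_K)` with a regular infinity type has, for all `ℓ`, `ι`, an
irreducible `ρ : Γ_K → GL₂(ℚ̄_ℓ)` with `IsGeometricFramed RD ρ` and `Corresponds RD ι π ρ` (Satake a.e.
+ local–global compatibility at EVERY finite place).

The item text calls it "in-tree named facts repackaged as `RD := ⟨llc⟩`". Since the statement re-type
of 2026-08-16/17 that packaging NO LONGER TYPE-CHECKS: `Summit.Langlands.ReciprocityData` now carries,
besides `llc`, the pins `llc_isCanonical` (the local Artin map of every `llc v` IS `canonicalArtin (K_v)`)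
and `llc_eps_isCanonical` (so are the Artin maps of its `ε`-system at every finite `E/K_v`), whereas the
named fact `Literature.NumberTheory.Automorphic.galoisRep_GL2_totallyReal_localGlobal` produces a bare
family `∃ llc` with no normalisation clause (its `(llc v).artin` is *a* `LocalArtinData`, four clauses,
which do not determine the map on the units). So the crux is now exactly: EXISTENCE (Carayol–Taylor–
Blasius–Rogawski) + IRREDUCIBILITY (Ribet) + LOCAL–GLOBAL COMPATIBILITY AT EVERY PLACE FOR HARRIS–TAYLOR'S
`rec_v` NORMALISED AGAINST THE ARTIN MAP OF CLASS FIELD THEORY (Carayol, Taylor, Saito, Skinner 2009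
Thm. 1, Blasius–Rogawski, T. Liu) — three printed theorems with three different proofs, and the
skeleton cuts along exactly those seams (one stub per theorem, each in the crux's own `L`-normalised
vocabulary over `Summits.Langlands.Langlands.Statement`):

* `stub_exists_attached_GL2_regular` (L; in print; in the tree = lang.S27 at `n = 2` transported along
  the half-twist `π ↦ π ⊗ |det|^{1/2}`, cf. the derived `exists_irreducible_satakeFrobCompatibleAE_GL2`
  of `Theorems/WachComponentCensusLiftB2UnramSplitPInPrint`, minus irreducibility) — for `K` totally
  real and `π` cuspidal on `GL₂(𝔸_K)`, `L`-algebraic with a regular infinity type, and every `ℓ`, `ι`: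
  SOME continuous `ρ : Γ_K → GL₂(ℚ̄_ℓ)` is Satake–Frobenius compatible with `π` at all but finitely many
  places (`Summit.Langlands.SatakeFrobCompatibleAt`: `π_v` unramified with parameter `α`, `ρ` unramified
  at `v`, arithmetic Frobenius with characteristic polynomial `∏ (X - ι⁻¹(α_j⁻¹))`). Congruences between
  Shimura-curve cohomology / Blasius–Rogawski motives; no irreducibility, no ramified places.
* `stub_irreducible_of_attached_GL2_regular` (M/L; Ribet's theorem, Skinner 2009 §2.4.2 + Remark;
  tree fact `galoisRep_GL2_totallyReal_irreducible` in the `C`-normalisation at every `v ∤ ℓ`, to be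
  transported by Chebotarev + Brauer–Nesbitt, `FramedGaloisRep.nonempty_equiv_of_hasFrobCharpolyAt_
  eventually`) — EVERY `ρ` Satake–Frobenius compatible a.e. with such a `π` is irreducible (a reducible
  `ρ` has reducible semisimplification `χ₁ ⊕ χ₂ ≅ ρ_{π,ι}^{ss}`; the `χ_i` are Hodge–Tate hence
  algebraic Hecke characters and `L(π ⊗ ψ₂⁻¹, s - 1/2) = L(ψ₁/ψ₂, s) ζ_K(s)` would have a pole).
* `stub_localGlobal_canonical_GL2_regular` (L/XL; Skinner 2009 Thm. 1 + (1) p. 242 for Harris–Taylor's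
  `Rec_v`, "normalized so that uniformizers correspond to geometric frobenius" BY LOCAL CLASS FIELD
  THEORY — i.e. against THE Artin map, the one with Milne's finite-level reciprocity law, which is what
  `IsCanonical` pins) — for `K` totally real there is ONE `RD : ReciprocityData K` (canonically
  normalised local Langlands data at every completion) such that for every such `π`, `ℓ`, `ι` and every
  IRREDUCIBLE `ρ` attached to `π` a.e.: `ρ|_{Γ_{K_v}}` is de Rham for Fontaine's pinned datum at every
  `v ∣ ℓ`, and `LocalGlobalCompatibleAt RD ι π ρ v` at EVERY finite `v`. This is the named fact
  `galoisRep_GL2_totallyReal_localGlobal` with `∃ llc` sharpened to `∃ RD` (the two pins), symbol for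
  symbol otherwise (`RD.pst ℓ v hv` is `fontainePstAdicCompletion v ℓ hv` by `rfl`); the sharpening is
  the only place where the tree's `IsLocalArtinMap.unique` / `exists_isLocalArtinMap` (local class field
  theory, build debt of `LocalClassFieldTheory`) and the `ε`-system pin enter.
* `RegularServed_of : stub₁ → stub₂ → stub₃ → RegularServed` — kernel-checked, no `sorry`: take `RD`
  from STUB 3; for `π` regular get `ρ` from STUB 1, its irreducibility from STUB 2, de Rham + all-places
  compatibility from STUB 3, and read the "unramified almost everywhere" half of `IsGeometricFramed` off
  the Satake clause (`SatakeFrobCompatibleAt` is conjunctive: it contains `ρ.IsUnramifiedAt v`). All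
  three stubs are load-bearing (STUB 3 only speaks about irreducible attached `ρ`, STUB 1 gives no
  irreducibility, STUB 2 no existence).

Shape (for `ledger skeleton check` / `#h21_check_skeleton`): stubs `theorem stub_<name> : <signature> :=
by sorry` (closed statements over existing declarations only, fully qualified); `_Goal.stub_<name> :
Prop := type_of% @stub_<name>` names each statement; the composition takes the three `_Goal`s by name
and concludes the route decl BY (fully qualified) NAME; the final `example` feeds the stubs to it.
Sorries: exactly the three stubs. Imports: the route module + Mathlib + HarnessLib (nothing from
`Theorems/`, several of which still build `ReciprocityData` with one field).

Disproof used: none exists — `ledger crux ls stmt-Langlands-16306` lists no workfiles (no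
`Disproof.lean`, no `Negative/` lemma, no dead line, no crux ideas) at registration (2026-08-17). Item
evidence: the grounder's `RegularServedOfFacts.lean` (2026-08-16T18:47Z, `RD := ⟨llc⟩` from the three
named facts — written against the ONE-field `ReciprocityData`, i.e. before the pins; its seam is kept,
its packaging is what STUB 3 now has to earn). `ledger negatives --problem Langlands` (3 entries:
SplitPrimeInductionDeinduction — Frobenius-data exceptional set; OrdinaryPrimeTransportRankinSelberg-
PoleCount; K3KugaSatakeDescentSerreTypeAnchor) contains nothing of the shape of these stubs.
-/

set_option linter.dupNamespace false

noncomputable section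

namespace Summit.Langlands.Langlands.Cruxes.RegularServed.Birth

open Summit.Langlands.Langlands.Theses.SenNullAlignment
open Filter

/-! ## 1. The three stubs -/

/-- **STUB 1 — existence of an attached `ℓ`-adic representation, `L`-normalised** (Carayol 1986,
Taylor 1989, Blasius–Rogawski 1993 = lang.S27 `exists_galoisRep_of_regularAlgebraic` at `n = 2` over a
totally real field, transported along `π ↦ π ⊗ |det|^{1/2}`): for `K` totally real, `π` cuspidal on
`GL₂(𝔸_K)`, `L`-algebraic with a regular infinity type, `ℓ` prime and `ι : ℚ̄_ℓ ≃ ℂ`, there is a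
continuous `ρ : Γ_K → GL₂(ℚ̄_ℓ)` such that at all but finitely many finite places `v`, `π_v` is
unramified with Satake parameter `α`, `ρ` is unramified at `v` and the arithmetic Frobenius has
characteristic polynomial `∏_j (X - ι⁻¹(α_j⁻¹))` (`Summit.Langlands.SatakeFrobCompatibleAt`, the summit's
clause, `m = 1`). No irreducibility, nothing at the ramified places or above `ℓ`.
[cite: TaylorInventMath1989, Theorem] [cite: CarayolASENS1986, Thm. (A)]
[cite: BuzzardGeeLMS2014, Conj. 3.2.1 and §5.3] -/
theorem stub_exists_attached_GL2_regular :
    ∀ (K : Type) [Field K] [NumberField K], NumberField.IsTotallyReal K →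
      ∀ (hcpt : Literature.NumberTheory.Automorphic.isCompact_glFiniteIntegralLevel 2 K)
        (π : Literature.NumberTheory.Automorphic.CuspidalAutomorphicRepData 2 K hcpt),
        π.1.IsLAlgebraic →
        (∃ T : Literature.NumberTheory.Automorphic.InfinityType K 2,
          π.1.HasInfinityType T ∧ T.IsRegular) →
        ∀ (ℓ : ℕ) [Fact ℓ.Prime] (ι : PadicAlgCl ℓ ≃+* ℂ),
          ∃ ρ : Literature.NumberTheory.GaloisRepresentations.FramedGaloisRep K (PadicAlgCl ℓ) 2,
            ∀ᶠ v : IsDedekindDomain.HeightOneSpectrum (NumberField.RingOfIntegers K) in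
              Filter.cofinite, Summit.Langlands.SatakeFrobCompatibleAt ι π.1 ρ v := by
  sorry

/-- **STUB 2 — irreducibility of every attached representation** (Ribet; Skinner 2009 §2.4.2, p. 257
and the Remark following it; Taylor 1995 Prop. 1.5; tree fact `galoisRep_GL2_totallyReal_irreducible`,
stated there in the `C`-normalisation at every `v ∤ ℓ` — here in the crux's form): for `K` totally
real, `π` cuspidal on `GL₂(𝔸_K)`, `L`-algebraic with a regular infinity type, `ℓ`, `ι`, EVERY continuous
`ρ : Γ_K → GL₂(ℚ̄_ℓ)` Satake–Frobenius compatible with `π` at all but finitely many places is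
irreducible. (A.e. compatibility pins `ρ^{ss}` by Chebotarev + Brauer–Nesbitt — the tree's proved
`FramedGaloisRep.nonempty_equiv_of_hasFrobCharpolyAt_eventually` — and a reducible `ρ` has a reducible
semisimplification, which Ribet's pole argument excludes for cuspidal `π`.)
[cite: Skinner2009, §2.4.2 (p. 257) and the Remark following it] [cite: Taylor1995HMFII, Prop. 1.5] -/
theorem stub_irreducible_of_attached_GL2_regular :
    ∀ (K : Type) [Field K] [NumberField K], NumberField.IsTotallyReal K →
      ∀ (hcpt : Literature.NumberTheory.Automorphic.isCompact_glFiniteIntegralLevel 2 K)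
        (π : Literature.NumberTheory.Automorphic.CuspidalAutomorphicRepData 2 K hcpt),
        π.1.IsLAlgebraic →
        (∃ T : Literature.NumberTheory.Automorphic.InfinityType K 2,
          π.1.HasInfinityType T ∧ T.IsRegular) →
        ∀ (ℓ : ℕ) [Fact ℓ.Prime] (ι : PadicAlgCl ℓ ≃+* ℂ)
          (ρ : Literature.NumberTheory.GaloisRepresentations.FramedGaloisRep K (PadicAlgCl ℓ) 2),
          (∀ᶠ v : IsDedekindDomain.HeightOneSpectrum (NumberField.RingOfIntegers K) in
              Filter.cofinite, Summit.Langlands.SatakeFrobCompatibleAt ι π.1 ρ v) →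
          ρ.toGaloisRep.IsIrreducible := by
  sorry

/-- **STUB 3 — local–global compatibility at EVERY finite place, and de Rham above `ℓ`, for ONE
family of CANONICALLY normalised local Langlands data** (Carayol 1986; Taylor 1989; Blasius–Rogawski
1993; at `v ∣ ℓ` Saito and Skinner 2009, Thm. 1 with (1), p. 242: `WD(ρ_π|_{D_v})^{Fr-ss} ≅
ι Rec_v(π_v ⊗ |·|^{-1/2})` for Harris–Taylor's `Rec_v`, "normalized so that uniformizers correspond to
geometric frobenius" by local class field theory): for every totally real `K` there are reciprocity data
`RD : Summit.Langlands.ReciprocityData K` — a local Langlands datum at every completion whose Artin map,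
and those of its `ε`-system, are THE canonical ones (`llc_isCanonical`, `llc_eps_isCanonical`) — such
that for every cuspidal `π` on `GL₂(𝔸_K)`, `L`-algebraic with a regular infinity type, every `ℓ`, `ι`
and every IRREDUCIBLE continuous `ρ : Γ_K → GL₂(ℚ̄_ℓ)` Satake–Frobenius compatible with `π` a.e.:
(i) `ρ|_{Γ_{K_v}}` is de Rham at every `v ∣ ℓ` for Fontaine's pinned datum (`RD.pst ℓ v hv =
fontainePstAdicCompletion v ℓ hv` by `rfl`), and (ii) `Summit.Langlands.LocalGlobalCompatibleAt RD ι π ρ v`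
at EVERY finite `v` (local component `π_v`, `r_v = WD(ρ|_{Γ_{K_v}})` by Grothendieck–Deligne at `v ∤ ℓ`
/ Fontaine's `WD ∘ D_pst` at `v ∣ ℓ`, transport `ι(r_v)`, `ι(r_v)^{F-ss} ≅ rec_v(π_v)`). This is the
named fact `galoisRep_GL2_totallyReal_localGlobal` with `∃ llc` sharpened to `∃ RD`, i.e. PLUS the
canonical normalisation of Harris–Taylor's data (local class field theory: the tree's
`exists_isLocalArtinMap` / `IsLocalArtinMap.unique`, and the `ε`-system pin) — the one clause the
2026-08-16 pins added to the crux. [cite: Skinner2009, (1) p. 242 and Thm. 1]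
[cite: CarayolASENS1986, Thm. (A)] [cite: HarrisTaylorAMS2001, Thm. A]
[cite: SerreLocalFields1979, Ch. XIII §4 Thm. 1–2] -/
theorem stub_localGlobal_canonical_GL2_regular :
    ∀ (K : Type) [Field K] [NumberField K], NumberField.IsTotallyReal K →
      ∃ RD : Summit.Langlands.ReciprocityData K,
        ∀ (hcpt : Literature.NumberTheory.Automorphic.isCompact_glFiniteIntegralLevel 2 K)
          (π : Literature.NumberTheory.Automorphic.CuspidalAutomorphicRepData 2 K hcpt),
          π.1.IsLAlgebraic →
          (∃ T : Literature.NumberTheory.Automorphic.InfinityType K 2,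
            π.1.HasInfinityType T ∧ T.IsRegular) →
          ∀ (ℓ : ℕ) [Fact ℓ.Prime] (ι : PadicAlgCl ℓ ≃+* ℂ)
            (ρ : Literature.NumberTheory.GaloisRepresentations.FramedGaloisRep K (PadicAlgCl ℓ) 2),
            ρ.toGaloisRep.IsIrreducible →
            (∀ᶠ v : IsDedekindDomain.HeightOneSpectrum (NumberField.RingOfIntegers K) in
                Filter.cofinite, Summit.Langlands.SatakeFrobCompatibleAt ι π.1 ρ v) →
            (∀ (v : IsDedekindDomain.HeightOneSpectrum (NumberField.RingOfIntegers K))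
                (hv : ((ℓ : ℕ) : NumberField.RingOfIntegers K) ∈ v.asIdeal),
                (RD.pst ℓ v hv).IsDeRhamFramed (ρ.toLocal v)) ∧
              ∀ v : IsDedekindDomain.HeightOneSpectrum (NumberField.RingOfIntegers K),
                Summit.Langlands.LocalGlobalCompatibleAt RD ι π.1 ρ v := by
  sorry

/-! ## 2. The stub statements as named propositions (the composition's hypotheses, by name)

`_Goal` is internal on purpose: audits listing the file's declarations by short name find the `stub_*`
THEOREMS, while `#h21_check_skeleton` accepts the hypotheses of `RegularServed_of` by the stub names
they carry. Each `_Goal.stub_x` is `type_of% @stub_x` — no text duplicated, no `sorry` inherited. -/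

namespace _Goal

/-- The statement of `stub_exists_attached_GL2_regular`, as a named `Prop` (literally its type).
[folklore] -/
def stub_exists_attached_GL2_regular : Prop :=
  type_of% @Summit.Langlands.Langlands.Cruxes.RegularServed.Birth.stub_exists_attached_GL2_regular

/-- The statement of `stub_irreducible_of_attached_GL2_regular`, as a named `Prop` (literally its
type). [folklore] -/
def stub_irreducible_of_attached_GL2_regular : Prop :=
  type_of% @Summit.Langlands.Langlands.Cruxes.RegularServed.Birth.stub_irreducible_of_attached_GL2_regular

/-- The statement of `stub_localGlobal_canonical_GL2_regular`, as a named `Prop` (literally its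
type). [folklore] -/
def stub_localGlobal_canonical_GL2_regular : Prop :=
  type_of% @Summit.Langlands.Langlands.Cruxes.RegularServed.Birth.stub_localGlobal_canonical_GL2_regular

end _Goal

/-! ## 3. The composition (kernel-checked, no `sorry`): existence + irreducibility + canonical LGC
→ the crux by name -/

/-- **`RegularServed` from the three stubs.** Fix `K` totally real and take the canonically
normalised reciprocity data `RD` of STUB 3. For `π` cuspidal, `L`-algebraic with a regular infinity
type and `ℓ`, `ι`: STUB 1 gives `ρ` attached to `π` a.e., STUB 2 its irreducibility, STUB 3 (which needs
that irreducibility) de Rham above `ℓ` and `LocalGlobalCompatibleAt RD ι π ρ v` at every finite `v`;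
the remaining half of `IsGeometricFramed RD ρ` — unramified at all but finitely many `v` — is read off
the conjunctive Satake clause. The hypotheses are, by name, the statements of the three stubs; the
conclusion is the route decl `Summit.Langlands.Langlands.Theses.SenNullAlignment.RegularServed`.
[folklore] -/
theorem RegularServed_of (h₁ : _Goal.stub_exists_attached_GL2_regular)
    (h₂ : _Goal.stub_irreducible_of_attached_GL2_regular)
    (h₃ : _Goal.stub_localGlobal_canonical_GL2_regular) :
    Summit.Langlands.Langlands.Theses.SenNullAlignment.RegularServed := by
  unfold _Goal.stub_exists_attached_GL2_regular at h₁
  unfold _Goal.stub_irreducible_of_attached_GL2_regular at h₂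
  unfold _Goal.stub_localGlobal_canonical_GL2_regular at h₃
  intro K _ _ hK
  -- the canonically normalised reciprocity data serving every regular `π` over `K` (STUB 3)
  obtain ⟨RD, hRD⟩ := h₃ K hK
  refine ⟨RD, ?_⟩
  intro hcpt π hL hreg ℓ _ ι
  -- an attached representation (STUB 1), irreducible (STUB 2)
  obtain ⟨ρ, hae⟩ := h₁ K hK hcpt π hL hreg ℓ ι
  have hirr : ρ.toGaloisRep.IsIrreducible := h₂ K hK hcpt π hL hreg ℓ ι ρ hae
  -- de Rham above `ℓ` and local–global compatibility at every finite place (STUB 3)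
  obtain ⟨hdR, hlgc⟩ := hRD hcpt π hL hreg ℓ ι ρ hirr hae
  refine ⟨ρ, hirr, ⟨hae.mono fun v hv => ?_, hdR⟩, hae, hlgc⟩
  -- unramified a.e.: the Satake clause is conjunctive
  obtain ⟨α, -, hur, -⟩ := hv
  exact hur

/-- By-name sanity check (an `example`, not a declaration of the file): the three stubs feed the
composition as they stand. -/
example : Summit.Langlands.Langlands.Theses.SenNullAlignment.RegularServed :=
  RegularServed_of stub_exists_attached_GL2_regular stub_irreducible_of_attached_GL2_regular
    stub_localGlobal_canonical_GL2_regular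

end Summit.Langlands.Langlands.Cruxes.RegularServed.Birth

end
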